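import Literature.MathematicalPhysics.QuantumFieldTheory.Balaban1983to89.B14SeparationOfRecord
import Literature.MathematicalPhysics.QuantumFieldTheory.Balaban1983to89.B15Claim189CubePin
import Literature.MathematicalPhysics.QuantumFieldTheory.Balaban1983to89.Node00.Record12ResidualsSlots
import Literature.MathematicalPhysics.QuantumFieldTheory.Balaban1983to89.T4SmallFieldWindowSandwich

/-!
# NODE 00 — def-T's STEP WEIGHTS OF RECORD AT A NO-EXPANSION NEW SEQUENCE: the fibre of the index map (3.5)∕(3.20) over a new pair
# `(Ω_{k+1}, Λ_{k+1}) = (∅, ∅)`, the CLOSED FORM of the resummed weight there (the residual `ζ` drops out), and the two EXTREME LABELS of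
# the first step — every χ₁-cube (3.2)-large ⇒ `w(s′₀)(U,V₁) = 1` for every `U`; every χ₁-cube (3.2)-small and (3.3)-large ⇒ `w(s′₀)(U,V₁) = 1`

Cell `pub-ymgap`, YM-PLAN Track A (HUMAN RULING D-0062), seat `pub-ymgap-dag-n11-d` (g5; R134 fan-out seat N11 [B14], strategy s2), lane K1‴
`StabilityBAtRecordR13e` = stmt-QuantumFields-19910.  [III] = [Balaban1988Convergent] (CMP **119** (1988) 243–285, §3 pp. 264–270).  Analysis lemmas on
the definer's OWN objects — node00-def-T ₇b `Node00.StepWeightsOfRecord` (labels `(P,Q,R,S)_{k+1}`, index map `σOfRecord`, label weights `a·b·ζ`, resummed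
step weights `wOfRecord`) — over seat dag-n11-e's `B14SeparationOfRecord` (membership readers for `hullD`∕`fillD`), `B15Claim189CubePin` (the cube of a
torus site), K0b's `Record12ResidualsSlots` (measurable `U`-sections of the (3.3) weights) and `T4SmallFieldWindowSandwich` (bond → plaquette deviation).

WHY THIS FILE (the kernel half of the cell's located question Q-W, pub-ymgap INBOX dag-lead ME #15 ∕ lit-balaban DESK-ANSWER 2026-08-27).  This seat's
`Thm/BalabanUVNodesN11NoExpansionRoughFibre` (p496847) proved: at every Stage-13 witness, N11's first (S1ᵀ)₁₃ instance `TLaw₁₃ θ p 0` forces def-T's pre-𝐑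
slot of the ALL-LARGE-FIELD new sequence `s′₀` (`Ω₁ = Λ₁ = ∅`), `slotT_1(s′₀)(V₁) = T[w(s′₀)(·,V₁)ρ₀](V₁)`, to vanish for a.e. rough `V₁`.  Whether it does is
a question about the step weight `w(s′₀)` ALONE.  This file computes it:
* §1 THE FIBRE of `σOfRecord s` over a new sequence `s′` with `Ω_{k+1}(s′) = ∅` is the set of labels `t` with `Ω_{k+1}(t) = ∅` (`OmegaOfLabel` reads `(P,Q)`
  only and `Λ_{k+1}(t) ⊆ Ω_{k+1}(t)`): `σOfRecord_eq_iff_OmegaOfLabel_eq_empty`.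
* §2 THE CLOSED FORM under the displayed ζ-unity `IsZetaUnity`: **`w(s′)(U,V′) = Σ_{(P,Q) : Ω_{k+1}(P,Q) = ∅} a(P)(V′)·b(P,Q)(U,V′)`** — the residual
  fluctuation factor `ζ_{k+1}(R,S)` DROPS OUT (every `(R,S)` lies in the fibre once `(P,Q)` does); hence `0 ≤ w(s′) ≤ 1`, single-label and single-`P`
  lower bounds, and measurability of the `U`-sections for EVERY `ζ` with unity (K0b's `measurable_bWeight_section`).
* §3 LAYER ALGEBRA AT THE FIRST STEP (`k = 0`: no large-field window, `Z_0 = ∅`): `hullD … ∅ = ∅`, `hullD … univ = univ`, the χ₁-cubes and the 𝐃₁-cubes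
  cover the torus (`0 <` their sides), `cubes32 = univ`, `Bdom univ = ∅`, `Bdom ∅ = univ`, `qcubes ∅ = univ`; so **the all-(3.2)-large label `P = univ` has
  `Ω₁ = ∅` for every `Q`**, and **the all-(3.2)-small ∕ all-(3.3)-large label `(P,Q) = (∅, univ)` has `Ω₁ = ∅`**.
* §4 THE TWO EXTREME LABELS' WEIGHTS: `a(univ)(V′) = 1` iff every χ₁-cube is (3.2)-large at `V′` (def-R's localized background (2.16) has a plaquette
  `≥ ε₁η₁²` off `1` in every `□^∼`), whence **`w(s′₀)(U,V₁) = 1` for EVERY `U`**; `a(∅)(V′) = 1` iff every χ₁-cube is (3.2)-small; `b(∅, univ)(U,V′) = 1` iff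
  no cube satisfies the small-approximate-fluctuation condition (3.3); and THE (3.3)-LARGENESS FROM ROUGHNESS, in EITHER branch of def-R's (2.12) solution
  map: on a (3.2)-small cube a plaquette `q ⊂ □^∼` of `U` with `dist1 (U(∂q)) ≥ ε₁η₁² + 4·(2δ₀)` violates (3.3) (`dist1_plaqHol_le_add_of_plaqBonds`) — whence
  **`w(s′₀)(U,V₁) = 1` whenever every χ₁-cube is (3.2)-small at `V₁` and `U` is cube-rough**.

HONEST SCOPE.  Finite resummation + set algebra on the torus + one group-norm inequality; nothing of Bałaban's estimates asserted ((3.6)–(3.9),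
(3.12)–(3.19), Thm 2 untouched); no positivity or sign law of `ζ` used (only `IsZetaUnity`); which (2.12) branch def-R's `UminOfRecord` takes at rough data is
NOT decided here.  Counts unmoved (typed 28∕28 · discharged 5∕28); count-neutral; one finite torus at fixed `ε = L^{−K}` — NOT ℝ⁴ ∕ OS ∕ mass gap ∕ Clay.
No `sorry`, no `axiom`, no `def`, no `instance`, no `notation`.
-/

noncomputable section

open MeasureTheory
open scoped BigOperators

namespace Literature.MathematicalPhysics.QuantumFieldTheory.Balaban1983to89.Node00

open T4Continuum B14.Eq218Concrete B15DeterminingSets B14.Eq213DetSet B14.Eq216Concrete B14.Eq213MaximalDomains B15Eq112TorusCover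
open B14DomainGeom B14.Sect3Decomp
open B14SeparationOfRecord (mem_hullD_iff mem_fillD_iff)
open B15Claim189CubePin (cubeOfSite cubeOfSite_mem_cubeIndices mem_cubeEnl_cubeOfSite plaq_mem_plaqInside_cubeEnl_src)
open T4TiltOscillation (bdev)
open T4SmallFieldWindowSandwich (plaqBonds dist1_plaqHol_le_add_of_plaqBonds)
open GaugeField (plaqHol)

/-! ## §1  The fibre of the index map over a no-expansion new sequence -/

section Fibre

variable (F : T4Family) (ν : Stage7Numerics) (M : ℕ) (p : B12.RunParams) (g : ℕ → ℝ) (k : ℕ)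

/-- `Ω_{k+1}(t)` of record reads the label only through `(P_{k+1}, Q_{k+1})`. [cite: Balaban1988Convergent, (3.5) p.265 (bookkeeping)] -/
theorem OmegaOfLabel_eq_of_PQ (s : SeqOfRecord F ν M g p.K k) (Pl Ql : Finset (Iχ F ν p g k))
    (RS RS' : Finset (Iχ F ν p g k) × Finset (Iχ F ν p g k)) :
    OmegaOfLabel F ν M p g k s (Pl, Ql, RS) = OmegaOfLabel F ν M p g k s (Pl, Ql, RS') := rfl

/-- A new sequence with `Ω_{k+1} = ∅` has `Λ_{k+1} = ∅` ((2.1): `Λ_{k+1} ⊆ Ω_{k+1}`). [cite: Balaban1988Convergent, (2.1) p.254] -/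
theorem Seq_Λ_succ_eq_empty_of_Ω (s' : SeqOfRecord F ν M g p.K (k + 1)) (hΩ : s'.Ω (k + 1) = ∅) : s'.Λ (k + 1) = ∅ :=
  Set.subset_eq_empty (s'.chain.Λ_subset (k + 1) (Nat.succ_pos k) le_rfl) hΩ

/-- **THE FIBRE OVER A NO-EXPANSION NEW SEQUENCE**: for `s′` with `init s′ = s` and `Ω_{k+1}(s′) = ∅`, a label `t = (P,Q,R,S)_{k+1}` is mapped to `s′` by
the index map (3.5)∕(3.20) iff its `Ω_{k+1}(t)` is empty (then `Λ_{k+1}(t) ⊆ Ω_{k+1}(t)` is empty too).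
[cite: Balaban1988Convergent, (3.5) p.265, (3.20) p.269, (2.1) p.254] -/
theorem σOfRecord_eq_iff_OmegaOfLabel_eq_empty (s : SeqOfRecord F ν M g p.K k) (s' : SeqOfRecord F ν M g p.K (k + 1))
    (hs : s'.init = s) (hΩ : s'.Ω (k + 1) = ∅) (t : LbOfRecord F ν p g k) :
    σOfRecord F ν M p g k s t = s' ↔ OmegaOfLabel F ν M p g k s t = ∅ := by
  constructor
  · intro h
    rw [← σOfRecord_Ω_succ F ν M p g k s t, h, hΩ]
  · intro hO
    have hL : LambdaOfLabel F ν M p g k s t = ∅ := Set.subset_eq_empty (LambdaOfLabel_subset F ν M p g k s t) hO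
    have hΛ' : s'.Λ (k + 1) = ∅ := Seq_Λ_succ_eq_empty_of_Ω F ν M p g k s' hΩ
    subst hs
    apply Seq.ext'
    · funext j
      by_cases hj : 1 ≤ j ∧ j ≤ k + 1
      · rcases Nat.lt_or_eq_of_le hj.2 with hlt | rfl
        · have hjk : j ≤ k := Nat.le_of_lt_succ hlt
          rw [σOfRecord, Seq.snoc_Ω_of_le _ _ hj.1 hjk, Seq.init_Ω _ hj.1 hjk]
        · rw [σOfRecord_Ω_succ, hO, hΩ]
      · rw [(σOfRecord F ν M p g k s'.init t).Ω_off j hj, s'.Ω_off j hj]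
    · funext j
      by_cases hj : 1 ≤ j ∧ j ≤ k + 1
      · rcases Nat.lt_or_eq_of_le hj.2 with hlt | rfl
        · have hjk : j ≤ k := Nat.le_of_lt_succ hlt
          rw [σOfRecord, Seq.snoc_Λ_of_le _ _ hj.1 hjk, Seq.init_Λ _ hj.1 hjk]
        · rw [σOfRecord_Λ_succ, hL, hΛ']
      · rw [(σOfRecord F ν M p g k s'.init t).Λ_off j hj, s'.Λ_off j hj]

end Fibre

/-! ## §2  The closed form of the resummed step weight at a no-expansion new sequence (ζ drops out) -/

section ClosedForm

variable (F : T4Family) (N : ℕ) [NeZero N] (ν : Stage7Numerics) (M : ℕ) (A₁ : ℝ) (p : B12.RunParams) (g : ℕ → ℝ) (k : ℕ)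

open Classical in
/-- The step weight of a no-expansion new sequence is the sum of the label weights over the labels with empty `Ω_{k+1}(t)`.
[cite: Balaban1988Convergent, (3.5) p.265, §3 p.267, p.270] -/
theorem wOfRecord_eq_sum_filter_OmegaOfLabel (ζ : ZetaOfRecord F N ν M) (s' : SeqOfRecord F ν M g p.K (k + 1)) (hΩ : s'.Ω (k + 1) = ∅)
    (U : GaugeField (F.P p.K) k (SU N)) (V' : GaugeField (F.P p.K) (k + 1) (SU N)) :
    wOfRecord F N ν M A₁ ζ p g k s' U V' =
      ∑ t ∈ Finset.univ.filter (fun t : LbOfRecord F ν p g k => OmegaOfLabel F ν M p g k s'.init t = ∅),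
        ωOfRecord F N ν M p g k A₁ ζ s'.init t U V' := by
  rw [wOfRecord_apply, resumWeights]
  refine Finset.sum_congr ?_ (fun _ _ => rfl)
  ext t
  simp only [Finset.mem_filter, Finset.mem_univ, true_and]
  exact σOfRecord_eq_iff_OmegaOfLabel_eq_empty F ν M p g k s'.init s' rfl hΩ t

open Classical in
/-- **THE CLOSED FORM** (ζ-unity): at a new sequence `s′` with `Ω_{k+1}(s′) = ∅`,
`w(s′)(U,V′) = Σ_P Σ_Q [Ω_{k+1}(P,Q) = ∅]·a(P)(V′)·b(P,Q)(U,V′)` — every `(R,S)` lies in the fibre once `(P,Q)` does, and `Σ_{(R,S)} ζ = 1`.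
[cite: Balaban1988Convergent, (3.2)–(3.5) p.265, (3.16) p.268, (3.20)–(3.21) p.269, §3 p.267] -/
theorem wOfRecord_eq_sum_aWeight_mul_bWeight_of_Omega_empty {ζ : ZetaOfRecord F N ν M} (hζ : IsZetaUnity F N ν M ζ)
    (s' : SeqOfRecord F ν M g p.K (k + 1)) (hΩ : s'.Ω (k + 1) = ∅)
    (U : GaugeField (F.P p.K) k (SU N)) (V' : GaugeField (F.P p.K) (k + 1) (SU N)) :
    wOfRecord F N ν M A₁ ζ p g k s' U V' =
      ∑ Pl : Finset (Iχ F ν p g k), ∑ Ql : Finset (Iχ F ν p g k),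
        if OmegaOfLabel F ν M p g k s'.init (Pl, Ql, (∅, ∅)) = ∅ then
          aWeight F N ν M p g k s'.init Pl V' * bWeight F N ν M p g k A₁ s'.init Pl Ql U V' else 0 := by
  rw [wOfRecord_eq_sum_filter_OmegaOfLabel F N ν M A₁ p g k ζ s' hΩ U V', Finset.sum_filter]
  simp only [Fintype.sum_prod_type]
  refine Finset.sum_congr rfl (fun Pl _ => Finset.sum_congr rfl (fun Ql _ => ?_))
  have hz : ∑ R : Finset (Iχ F ν p g k), ∑ S : Finset (Iχ F ν p g k), ζ p g k s'.init Pl Ql (R, S) U V' = 1 := by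
    rw [← hζ p g k s'.init Pl Ql U V', Fintype.sum_prod_type]
  by_cases hC : OmegaOfLabel F ν M p g k s'.init (Pl, Ql, (∅, ∅)) = ∅
  · have hC' : ∀ R S : Finset (Iχ F ν p g k), OmegaOfLabel F ν M p g k s'.init (Pl, Ql, (R, S)) = ∅ := fun R S => hC
    simp only [hC', if_true, ωOfRecord]
    conv_rhs => rw [← mul_one (aWeight F N ν M p g k s'.init Pl V' * bWeight F N ν M p g k A₁ s'.init Pl Ql U V'), ← hz]
    simp only [Finset.mul_sum]
  · have hC' : ∀ R S : Finset (Iχ F ν p g k), ¬ OmegaOfLabel F ν M p g k s'.init (Pl, Ql, (R, S)) = ∅ := fun R S => hC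
    simp only [hC', if_false, Finset.sum_const_zero]

/-- `0 ≤ w(s′)` at a no-expansion new sequence (no sign law of `ζ` needed). [cite: Balaban1988Convergent, (3.2)–(3.3) p.265 (bookkeeping)] -/
theorem wOfRecord_nonneg_of_Omega_empty {ζ : ZetaOfRecord F N ν M} (hζ : IsZetaUnity F N ν M ζ)
    (s' : SeqOfRecord F ν M g p.K (k + 1)) (hΩ : s'.Ω (k + 1) = ∅)
    (U : GaugeField (F.P p.K) k (SU N)) (V' : GaugeField (F.P p.K) (k + 1) (SU N)) :
    0 ≤ wOfRecord F N ν M A₁ ζ p g k s' U V' := by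
  rw [wOfRecord_eq_sum_aWeight_mul_bWeight_of_Omega_empty F N ν M A₁ p g k hζ s' hΩ U V']
  refine Finset.sum_nonneg fun Pl _ => Finset.sum_nonneg fun Ql _ => ?_
  split_ifs
  · exact mul_nonneg (aWeight_nonneg F N ν M p g k _ Pl V') (bWeight_nonneg F N ν M p g k A₁ _ Pl Ql U V')
  · exact le_rfl

/-- `w(s′) ≤ 1` at a no-expansion new sequence (drop the fibre condition; `Σ_Q b = 1`, `Σ_P a = 1`). [cite: Balaban1988Convergent, (3.2)–(3.3) p.265 (bookkeeping)] -/
theorem wOfRecord_le_one_of_Omega_empty {ζ : ZetaOfRecord F N ν M} (hζ : IsZetaUnity F N ν M ζ)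
    (s' : SeqOfRecord F ν M g p.K (k + 1)) (hΩ : s'.Ω (k + 1) = ∅)
    (U : GaugeField (F.P p.K) k (SU N)) (V' : GaugeField (F.P p.K) (k + 1) (SU N)) :
    wOfRecord F N ν M A₁ ζ p g k s' U V' ≤ 1 := by
  rw [wOfRecord_eq_sum_aWeight_mul_bWeight_of_Omega_empty F N ν M A₁ p g k hζ s' hΩ U V']
  calc ∑ Pl : Finset (Iχ F ν p g k), ∑ Ql : Finset (Iχ F ν p g k),
        (if OmegaOfLabel F ν M p g k s'.init (Pl, Ql, (∅, ∅)) = ∅ then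
          aWeight F N ν M p g k s'.init Pl V' * bWeight F N ν M p g k A₁ s'.init Pl Ql U V' else 0)
      ≤ ∑ Pl : Finset (Iχ F ν p g k), ∑ Ql : Finset (Iχ F ν p g k),
          aWeight F N ν M p g k s'.init Pl V' * bWeight F N ν M p g k A₁ s'.init Pl Ql U V' := by
        refine Finset.sum_le_sum fun Pl _ => Finset.sum_le_sum fun Ql _ => ?_
        split_ifs
        · exact le_rfl
        · exact mul_nonneg (aWeight_nonneg F N ν M p g k _ Pl V') (bWeight_nonneg F N ν M p g k A₁ _ Pl Ql U V')
    _ = ∑ Pl : Finset (Iχ F ν p g k), aWeight F N ν M p g k s'.init Pl V' *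
          ∑ Ql : Finset (Iχ F ν p g k), bWeight F N ν M p g k A₁ s'.init Pl Ql U V' := by
        simp only [Finset.mul_sum]
    _ = 1 := by
        simp only [sum_bWeight, mul_one]
        exact sum_aWeight F N ν M p g k _ V'

/-- **SINGLE-LABEL LOWER BOUND**: a label `(P,Q)` with `Ω_{k+1}(P,Q) = ∅` contributes `a(P)(V′)·b(P,Q)(U,V′) ≤ w(s′)(U,V′)`.
[cite: Balaban1988Convergent, (3.2)–(3.5) p.265 (bookkeeping)] -/
theorem aWeight_mul_bWeight_le_wOfRecord_of_OmegaOfLabel_eq_empty {ζ : ZetaOfRecord F N ν M} (hζ : IsZetaUnity F N ν M ζ)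
    (s' : SeqOfRecord F ν M g p.K (k + 1)) (hΩ : s'.Ω (k + 1) = ∅) (Pl Ql : Finset (Iχ F ν p g k))
    (hPQ : OmegaOfLabel F ν M p g k s'.init (Pl, Ql, (∅, ∅)) = ∅)
    (U : GaugeField (F.P p.K) k (SU N)) (V' : GaugeField (F.P p.K) (k + 1) (SU N)) :
    aWeight F N ν M p g k s'.init Pl V' * bWeight F N ν M p g k A₁ s'.init Pl Ql U V' ≤ wOfRecord F N ν M A₁ ζ p g k s' U V' := by
  classical
  rw [wOfRecord_eq_sum_aWeight_mul_bWeight_of_Omega_empty F N ν M A₁ p g k hζ s' hΩ U V']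
  have hnn : ∀ Pl' Ql' : Finset (Iχ F ν p g k), 0 ≤ (if OmegaOfLabel F ν M p g k s'.init (Pl', Ql', (∅, ∅)) = ∅ then
      aWeight F N ν M p g k s'.init Pl' V' * bWeight F N ν M p g k A₁ s'.init Pl' Ql' U V' else 0) := by
    intro Pl' Ql'
    split_ifs
    · exact mul_nonneg (aWeight_nonneg F N ν M p g k _ Pl' V') (bWeight_nonneg F N ν M p g k A₁ _ Pl' Ql' U V')
    · exact le_rfl
  calc aWeight F N ν M p g k s'.init Pl V' * bWeight F N ν M p g k A₁ s'.init Pl Ql U V'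
      = (if OmegaOfLabel F ν M p g k s'.init (Pl, Ql, (∅, ∅)) = ∅ then
          aWeight F N ν M p g k s'.init Pl V' * bWeight F N ν M p g k A₁ s'.init Pl Ql U V' else 0) := by rw [if_pos hPQ]
    _ ≤ ∑ Ql' : Finset (Iχ F ν p g k), (if OmegaOfLabel F ν M p g k s'.init (Pl, Ql', (∅, ∅)) = ∅ then
          aWeight F N ν M p g k s'.init Pl V' * bWeight F N ν M p g k A₁ s'.init Pl Ql' U V' else 0) :=
        Finset.single_le_sum (fun Ql' _ => hnn Pl Ql') (Finset.mem_univ Ql)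
    _ ≤ _ := Finset.single_le_sum (fun Pl' _ => Finset.sum_nonneg fun Ql' _ => hnn Pl' Ql') (Finset.mem_univ Pl)

/-- **SINGLE-`P` LOWER BOUND**: if EVERY `Q` gives `Ω_{k+1}(P,Q) = ∅`, then `a(P)(V′) ≤ w(s′)(U,V′)` (`Σ_Q b(P,Q) = 1`).
[cite: Balaban1988Convergent, (3.2)–(3.5) p.265 (bookkeeping)] -/
theorem aWeight_le_wOfRecord_of_forall_OmegaOfLabel_eq_empty {ζ : ZetaOfRecord F N ν M} (hζ : IsZetaUnity F N ν M ζ)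
    (s' : SeqOfRecord F ν M g p.K (k + 1)) (hΩ : s'.Ω (k + 1) = ∅) (Pl : Finset (Iχ F ν p g k))
    (hP : ∀ Ql : Finset (Iχ F ν p g k), OmegaOfLabel F ν M p g k s'.init (Pl, Ql, (∅, ∅)) = ∅)
    (U : GaugeField (F.P p.K) k (SU N)) (V' : GaugeField (F.P p.K) (k + 1) (SU N)) :
    aWeight F N ν M p g k s'.init Pl V' ≤ wOfRecord F N ν M A₁ ζ p g k s' U V' := by
  classical
  rw [wOfRecord_eq_sum_aWeight_mul_bWeight_of_Omega_empty F N ν M A₁ p g k hζ s' hΩ U V']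
  have hnn : ∀ Pl' Ql' : Finset (Iχ F ν p g k), 0 ≤ (if OmegaOfLabel F ν M p g k s'.init (Pl', Ql', (∅, ∅)) = ∅ then
      aWeight F N ν M p g k s'.init Pl' V' * bWeight F N ν M p g k A₁ s'.init Pl' Ql' U V' else 0) := by
    intro Pl' Ql'
    split_ifs
    · exact mul_nonneg (aWeight_nonneg F N ν M p g k _ Pl' V') (bWeight_nonneg F N ν M p g k A₁ _ Pl' Ql' U V')
    · exact le_rfl
  calc aWeight F N ν M p g k s'.init Pl V'
      = aWeight F N ν M p g k s'.init Pl V' * ∑ Ql' : Finset (Iχ F ν p g k), bWeight F N ν M p g k A₁ s'.init Pl Ql' U V' := by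
        rw [sum_bWeight, mul_one]
    _ = ∑ Ql' : Finset (Iχ F ν p g k), (if OmegaOfLabel F ν M p g k s'.init (Pl, Ql', (∅, ∅)) = ∅ then
          aWeight F N ν M p g k s'.init Pl V' * bWeight F N ν M p g k A₁ s'.init Pl Ql' U V' else 0) := by
        rw [Finset.mul_sum]
        exact Finset.sum_congr rfl fun Ql' _ => by rw [if_pos (hP Ql')]
    _ ≤ _ := Finset.single_le_sum (fun Pl' _ => Finset.sum_nonneg fun Ql' _ => hnn Pl' Ql') (Finset.mem_univ Pl)

/-- If `a(P)(V′) = 1` for a `P` all of whose `Q` give `Ω_{k+1}(P,Q) = ∅`, then `w(s′)(U,V′) = 1` for EVERY `U`.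
[cite: Balaban1988Convergent, (3.2)–(3.5) p.265 (bookkeeping)] -/
theorem wOfRecord_eq_one_of_aWeight_eq_one {ζ : ZetaOfRecord F N ν M} (hζ : IsZetaUnity F N ν M ζ)
    (s' : SeqOfRecord F ν M g p.K (k + 1)) (hΩ : s'.Ω (k + 1) = ∅) (Pl : Finset (Iχ F ν p g k))
    (hP : ∀ Ql : Finset (Iχ F ν p g k), OmegaOfLabel F ν M p g k s'.init (Pl, Ql, (∅, ∅)) = ∅)
    (U : GaugeField (F.P p.K) k (SU N)) (V' : GaugeField (F.P p.K) (k + 1) (SU N)) (ha : aWeight F N ν M p g k s'.init Pl V' = 1) :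
    wOfRecord F N ν M A₁ ζ p g k s' U V' = 1 :=
  le_antisymm (wOfRecord_le_one_of_Omega_empty F N ν M A₁ p g k hζ s' hΩ U V')
    (ha ▸ aWeight_le_wOfRecord_of_forall_OmegaOfLabel_eq_empty F N ν M A₁ p g k hζ s' hΩ Pl hP U V')

/-- **THE `U`-SECTIONS OF `w(s′)` ARE MEASURABLE at a no-expansion new sequence, for EVERY residual `ζ` with unity** (the (3.2) factor and the fibre
condition are constants in `U`; K0b's `measurable_bWeight_section`). [cite: Balaban1988Convergent, (3.2)–(3.3) p.265 (bookkeeping)] -/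
theorem measurable_wOfRecord_section_of_Omega_empty {ζ : ZetaOfRecord F N ν M} (hζ : IsZetaUnity F N ν M ζ)
    (s' : SeqOfRecord F ν M g p.K (k + 1)) (hΩ : s'.Ω (k + 1) = ∅) (V' : GaugeField (F.P p.K) (k + 1) (SU N)) :
    Measurable (fun U : GaugeField (F.P p.K) k (SU N) => wOfRecord F N ν M A₁ ζ p g k s' U V') := by
  classical
  have heq : (fun U : GaugeField (F.P p.K) k (SU N) => wOfRecord F N ν M A₁ ζ p g k s' U V') =
      fun U => ∑ Pl : Finset (Iχ F ν p g k), ∑ Ql : Finset (Iχ F ν p g k),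
        if OmegaOfLabel F ν M p g k s'.init (Pl, Ql, (∅, ∅)) = ∅ then
          aWeight F N ν M p g k s'.init Pl V' * bWeight F N ν M p g k A₁ s'.init Pl Ql U V' else 0 :=
    funext fun U => wOfRecord_eq_sum_aWeight_mul_bWeight_of_Omega_empty F N ν M A₁ p g k hζ s' hΩ U V'
  rw [heq]
  refine Finset.measurable_sum _ fun Pl _ => Finset.measurable_sum _ fun Ql _ => ?_
  by_cases hC : OmegaOfLabel F ν M p g k s'.init (Pl, Ql, (∅, ∅)) = ∅
  · simp only [hC, if_true]
    exact measurable_const.mul (measurable_bWeight_section A₁ s'.init Pl Ql V')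
  · simp only [hC, if_false]
    exact measurable_const

end ClosedForm

/-! ## §3  Layer algebra at the first step: the extreme labels have empty `Ω₁` -/

section LayerZero

variable (P : Params) (s : ℕ)

/-- Collars are monotone: `□^{∼n} ⊆ □^{∼m}` for `n ≤ m`. [cite: Balaban1988Convergent, (2.16)–(2.17) p.257 (bookkeeping)] -/
theorem cubeEnl_mono (a : Pt P.d) {n m : ℕ} (h : n ≤ m) : cubeEnl P s a n ⊆ cubeEnl P s a m := by
  rintro x ⟨z, hz, rfl⟩
  refine ⟨z, fun i => ?_, rfl⟩
  have h1 := (hz i).1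
  have h2 := (hz i).2
  have hnm : (((n * s : ℕ)) : ℤ) ≤ ((m * s : ℕ) : ℤ) := by exact_mod_cast Nat.mul_le_mul_right s h
  constructor <;> linarith

/-- `hullD` of the empty set is empty. [cite: Balaban1988Convergent, p.264–265 (bookkeeping)] -/
theorem hullD_empty (n : ℕ) : hullD P s n (∅ : Set (Site P 0)) = ∅ := by
  ext x
  simp only [Set.mem_empty_iff_false, iff_false]
  intro hx
  obtain ⟨a, -, ⟨y, -, hy⟩, -⟩ := mem_hullD_iff.1 hx
  exact hy

/-- `hullD` of the whole torus is the whole torus (the `s`-cubes cover it, `0 < s`). [cite: Balaban1988Convergent, p.264–265 (bookkeeping)] -/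
theorem hullD_univ (hs : 0 < s) (n : ℕ) : hullD P s n (Set.univ : Set (Site P 0)) = Set.univ := by
  refine Set.eq_univ_of_forall fun x => mem_hullD_iff.2 ⟨cubeOfSite s x, cubeOfSite_mem_cubeIndices s hs x, ?_, mem_cubeEnl_cubeOfSite s hs x⟩
  exact ⟨x, cubeEnl_mono P s _ (Nat.zero_le n) (mem_cubeEnl_cubeOfSite s hs x), Set.mem_univ x⟩

/-- `fillD X ⊆ X`, so `fillD` of a set contained in `∅` is empty. [cite: Balaban1988Convergent, (2.1) p.254 (bookkeeping)] -/
theorem fillD_eq_empty_of_subset_empty {X : Set (Site P 0)} (h : X ⊆ ∅) : fillD P s X = ∅ :=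
  Set.subset_eq_empty ((fillD_subset P s X).trans h) rfl

variable (F : T4Family) (ν : Stage7Numerics) (M : ℕ) (p : B12.RunParams) (g : ℕ → ℝ) (k : ℕ)

/-- The empty family of χ-cubes covers nothing. [cite: Balaban1988Convergent, (3.2) p.265 (bookkeeping)] -/
theorem cubesχ_empty : cubesχ F ν p g k (∅ : Finset (Iχ F ν p g k)) = ∅ := by
  simp [cubesχ]

/-- ALL χ_{k+1}-cubes cover the torus (`0 <` their side). [cite: Balaban1988Convergent, (3.2) p.265, (2.17) p.257 (bookkeeping)] -/
theorem cubesχ_univ (hχ : 0 < sideχ F ν p g k) : cubesχ F ν p g k (Finset.univ : Finset (Iχ F ν p g k)) = Set.univ := by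
  refine Set.eq_univ_of_forall fun x => ?_
  simp only [cubesχ, Finset.mem_univ, Set.iUnion_true, Set.mem_iUnion]
  exact ⟨⟨cubeOfSite (sideχ F ν p g k) x, cubeOfSite_mem_cubeIndices _ hχ x⟩, mem_cubeEnl_cubeOfSite _ hχ x⟩

variable (s₀ : SeqOfRecord F ν M g p.K 0)

/-- At the first step there is no large-field region: `Z_0 = ∅`. [cite: Balaban1988Convergent, p.264 («the term has a large field region Z_k = Λ_kᶜ»; none at k = 0)] -/
theorem Zreg_zero : Zreg F ν M p g 0 s₀ = ∅ := by
  simp [Zreg]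

/-- `Z̃_0^{∼4} = ∅`. [cite: Balaban1988Convergent, p.264–265 (bookkeeping)] -/
theorem Ztilde4_zero : Ztilde4 F ν M p g 0 s₀ = ∅ := by
  rw [Ztilde4, Zreg_zero, hullD_empty, hullD_empty]

/-- The (3.2) window at the first step is the whole torus. [cite: Balaban1988Convergent, (3.2) p.265] -/
theorem W32_zero : W32 F ν M p g 0 s₀ = Set.univ := by
  rw [W32, Ztilde4_zero, Set.compl_empty]

/-- The (3.2) range at the first step is ALL χ₁-cubes. [cite: Balaban1988Convergent, (3.2) p.265] -/
theorem cubes32_zero : cubes32 F ν M p g 0 s₀ = Finset.univ := by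
  ext c
  simp only [cubes32, W32_zero, mem_cubesIn, Set.subset_univ, Finset.mem_univ]

/-- `B¹(P¹)` for the ALL-large label is empty: `(hullD 1 (hullD 0 univ ∪ ∅))ᶜ = ∅`. [cite: Balaban1988Convergent, p.265 (bookkeeping)] -/
theorem Bdom_zero_univ (hD : 0 < sideD F ν M p g 0) (hχ : 0 < sideχ F ν p g 0) :
    Bdom F ν M p g 0 s₀ Finset.univ = ∅ := by
  rw [Bdom, cubesχ_univ F ν p g 0 hχ, hullD_univ _ _ hD, Ztilde4_zero, Set.union_empty, hullD_univ _ _ hD, Set.compl_univ]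

/-- `B¹(P¹)` for the EMPTY `P` is the whole torus. [cite: Balaban1988Convergent, p.265 (bookkeeping)] -/
theorem Bdom_zero_empty : Bdom F ν M p g 0 s₀ ∅ = Set.univ := by
  rw [Bdom, cubesχ_empty, hullD_empty, Ztilde4_zero, Set.union_empty, hullD_empty, Set.compl_empty]

/-- The (3.3) range for the EMPTY `P` at the first step is ALL χ₁-cubes. [cite: Balaban1988Convergent, (3.3) p.265] -/
theorem qcubes_zero_empty : qcubes F ν M p g 0 s₀ ∅ = Finset.univ := by
  ext c
  simp only [qcubes, innerD, Bdom_zero_empty, Set.compl_univ, hullD_empty, Set.compl_empty, mem_cubesIn, Set.subset_univ,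
    Finset.mem_univ]

/-- **(3.5) for the ALL-(3.2)-LARGE label**: `Ω₁(univ, Q) = ∅` before the guard, for every `Q`. [cite: Balaban1988Convergent, (3.5) p.265] -/
theorem Omega0_zero_univ (hD : 0 < sideD F ν M p g 0) (hχ : 0 < sideχ F ν p g 0) (Ql : Finset (Iχ F ν p g 0)) :
    Omega0 F ν M p g 0 s₀ Finset.univ Ql = ∅ := by
  rw [Omega0, Bdom_zero_univ F ν M p g s₀ hD hχ, Set.compl_empty, hullD_univ _ _ hD, Set.union_univ, hullD_univ _ _ hD, Set.compl_univ]

/-- **(3.5) for the ALL-(3.2)-SMALL, ALL-(3.3)-LARGE label**: `Ω₁(∅, univ) = ∅` before the guard. [cite: Balaban1988Convergent, (3.5) p.265] -/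
theorem Omega0_zero_empty_univ (hD : 0 < sideD F ν M p g 0) (hχ : 0 < sideχ F ν p g 0) :
    Omega0 F ν M p g 0 s₀ ∅ Finset.univ = ∅ := by
  rw [Omega0, cubesχ_univ F ν p g 0 hχ, hullD_univ _ _ hD, Set.univ_union, hullD_univ _ _ hD, Set.compl_univ]

/-- **THE ALL-(3.2)-LARGE LABEL HAS `Ω₁ = ∅` FOR EVERY `Q` (and every `(R,S)`)** at the first step. [cite: Balaban1988Convergent, (3.5) p.265] -/
theorem OmegaOfLabel_zero_eq_empty_of_fst_eq_univ (hD : 0 < sideD F ν M p g 0) (hχ : 0 < sideχ F ν p g 0) (t : LbOfRecord F ν p g 0)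
    (ht : t.1 = Finset.univ) : OmegaOfLabel F ν M p g 0 s₀ t = ∅ := by
  rw [OmegaOfLabel, ht, Omega0_zero_univ F ν M p g s₀ hD hχ, Set.empty_inter]
  exact fillD_eq_empty_of_subset_empty _ _ le_rfl

/-- **THE ALL-(3.2)-SMALL ∕ ALL-(3.3)-LARGE LABEL HAS `Ω₁ = ∅`** at the first step. [cite: Balaban1988Convergent, (3.5) p.265] -/
theorem OmegaOfLabel_zero_empty_univ_eq_empty (hD : 0 < sideD F ν M p g 0) (hχ : 0 < sideχ F ν p g 0)
    (RS : Finset (Iχ F ν p g 0) × Finset (Iχ F ν p g 0)) : OmegaOfLabel F ν M p g 0 s₀ (∅, Finset.univ, RS) = ∅ := by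
  rw [OmegaOfLabel, Omega0_zero_empty_univ F ν M p g s₀ hD hχ, Set.empty_inter]
  exact fillD_eq_empty_of_subset_empty _ _ le_rfl

end LayerZero

/-! ## §4  The two extreme labels' weights, and (3.3)-largeness from roughness -/

section Extreme

variable (F : T4Family) (N : ℕ) [NeZero N] (ν : Stage7Numerics) (M : ℕ) (A₁ : ℝ) (p : B12.RunParams) (g : ℕ → ℝ) (k : ℕ)

/-- **`a(cubes32)(V′) = 1` when EVERY χ_{k+1}-cube of the (3.2) range is (3.2)-LARGE at `V′`** (the localized background (2.16) of every cube has a plaquette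
in `□^∼` with `|U_{k+1,□}(∂p) − 1| ≥ ε_{k+1}η²`). [cite: Balaban1988Convergent, (3.2) p.265] -/
theorem aWeight_cubes32_eq_one_of_forall_chiFactor_eq_zero (s : SeqOfRecord F ν M g p.K k) (V' : GaugeField (F.P p.K) (k + 1) (SU N))
    (h : ∀ c ∈ cubes32 F ν M p g k s, chiFactor F N ν p g k c V' = 0) :
    aWeight F N ν M p g k s (cubes32 F ν M p g k s) V' = 1 := by
  classical
  rw [aWeight, if_pos subset_rfl, chiNext_sect3DataOfRecord, Finset.sdiff_self, Finset.prod_empty, one_mul]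
  unfold chiNextc
  refine Finset.prod_eq_one fun c hc => ?_
  have hc0 : chiFactor F N ν p g k c V' = 0 := h c hc
  change 1 - chiFactor F N ν p g k c V' = 1
  rw [hc0, sub_zero]

/-- **`a(∅)(V′) = 1` when EVERY χ_{k+1}-cube of the (3.2) range is (3.2)-SMALL at `V′`**. [cite: Balaban1988Convergent, (3.2) p.265] -/
theorem aWeight_empty_eq_one_of_forall_chiFactor_eq_one (s : SeqOfRecord F ν M g p.K k) (V' : GaugeField (F.P p.K) (k + 1) (SU N))
    (h : ∀ c ∈ cubes32 F ν M p g k s, chiFactor F N ν p g k c V' = 1) :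
    aWeight F N ν M p g k s ∅ V' = 1 := by
  classical
  rw [aWeight, if_pos (Finset.empty_subset _), chiNext_sect3DataOfRecord, Finset.sdiff_empty]
  unfold chiNextc
  show (∏ c ∈ cubes32 F ν M p g k s, chiFactor F N ν p g k c V') *
      ∏ c ∈ (∅ : Finset (Iχ F ν p g k)), (1 - chiFactor F N ν p g k c V') = 1
  rw [Finset.prod_empty, mul_one]
  exact Finset.prod_eq_one fun c hc => h c hc

open Classical in
/-- **`b(P, qcubes P)(U,V′) = 1` when NO cube of the (3.3) range satisfies the small-approximate-fluctuation condition (3.3)** (all (3.3)-large).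
[cite: Balaban1988Convergent, (3.3) p.265] -/
theorem bWeight_qcubes_eq_one_of_forall_not_smallApproxFluct (s : SeqOfRecord F ν M g p.K k) (Pl : Finset (Iχ F ν p g k))
    (U : GaugeField (F.P p.K) k (SU N)) (V' : GaugeField (F.P p.K) (k + 1) (SU N))
    (h : ∀ c ∈ qcubes F ν M p g k s Pl, ¬ SmallApproxFluct (sect3DataOfRecord F N ν M p g k s) (avOfRecord F N p.K)
      (2 * deltaOfRecord ν g k A₁) U V' c) :
    bWeight F N ν M p g k A₁ s Pl (qcubes F ν M p g k s Pl) U V' = 1 := by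
  rw [bWeight, if_pos subset_rfl]
  unfold chiPrime chiPrimec
  rw [Finset.sdiff_self]
  show (∏ c ∈ (∅ : Finset (Iχ F ν p g k)),
      (if SmallApproxFluct (sect3DataOfRecord F N ν M p g k s) (avOfRecord F N p.K) (2 * deltaOfRecord ν g k A₁) U V' c
        then (1 : ℝ) else 0)) *
      ∏ c ∈ qcubes F ν M p g k s Pl,
        (if SmallApproxFluct (sect3DataOfRecord F N ν M p g k s) (avOfRecord F N p.K) (2 * deltaOfRecord ν g k A₁) U V' c
          then (0 : ℝ) else 1) = 1
  rw [Finset.prod_empty, one_mul]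
  exact Finset.prod_eq_one fun c hc => by rw [if_neg (h c hc)]

/-- `chiFactor = 1` unfolds to the (3.2) smallness of the localized background (2.16) on `□^∼`. [cite: Balaban1988Convergent, (3.2) p.265, (2.16)–(2.17) p.257] -/
theorem plaqSmallOn_ukBox_of_chiFactor_eq_one (c : Iχ F ν p g k) (V' : GaugeField (F.P p.K) (k + 1) (SU N))
    (h : chiFactor F N ν p g k c V' = 1) :
    PlaqSmallOn (plaqInside (cubeEnl (F.P p.K) (sideχ F ν p g k) c 1)) (epsOfRecord ν g (k + 1) * (F.P p.K).eta (k + 1) ^ 2)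
      (ukBox (bgOfRecord (avOfRecord F N p.K) {U | PlaqSmall (ν.εreg * (F.P p.K).eta (k + 1) ^ 2) U}) ν.M₁
        (cubeEnl (F.P p.K) (sideχ F ν p g k) c 4) (k + 1) V') := by
  by_contra hne
  unfold chiFactor chiSmall at h
  rw [if_neg hne] at h
  exact zero_ne_one h

/-- Unit shifts commute. [folklore] -/
private theorem shift_shift_comm {j : ℕ} (x : Site (F.P p.K) j) (μ' ν' : Fin (F.P p.K).d) :
    (x.shift μ').shift ν' = (x.shift ν').shift μ' := by
  by_cases h : μ' = ν'
  · subst h; rfl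
  · simp only [Site.shift]
    rw [Function.update_of_ne (Ne.symm h), Function.update_of_ne h, Function.update_comm h]

variable (s₀ : SeqOfRecord F ν M g p.K 0)

/-- At the first step the bonds `(□′^{∼2})^{(0)*}` of a χ₁-cube contain the boundary bonds of every plaquette inside `□′^∼`.
[cite: Balaban1988Convergent, (3.3) p.265 («b ∈ (□′^{∼2})^{(k)*}»), (2.17) p.257 («p ⊂ □^∼»)] -/
theorem plaqBonds_subset_bondsStar_zero (c : Iχ F ν p g 0) {q : Plaq (F.P p.K) 0}
    (hq : q ∈ plaqInside (cubeEnl (F.P p.K) (sideχ F ν p g 0) c 1)) :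
    ∀ b ∈ plaqBonds q, b ∈ (sect3DataOfRecord F N ν M p g 0 s₀).bondsStar c := by
  classical
  obtain ⟨h1, h2, h3, h4⟩ := (mem_plaqInside_iff _ q).1 hq
  have h12 := cubeEnl_mono (F.P p.K) (sideχ F ν p g 0) (c : Pt (F.P p.K).d) (show 1 ≤ 2 by norm_num)
  have h4' : (q.src.shift q.ν).shift q.μ ∈ cubeEnl (F.P p.K) (sideχ F ν p g 0) c 2 := by
    rw [← shift_shift_comm F p q.src q.μ q.ν]; exact h12 h4
  intro b hb
  simp only [plaqBonds, Set.mem_insert_iff, Set.mem_singleton_iff] at hb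
  show b ∈ Finset.univ.filter (fun b : PBond (F.P p.K) 0 =>
    embIter 0 b.src ∈ cubeEnl (F.P p.K) (sideχ F ν p g 0) c 2 ∧ embIter 0 b.tgt ∈ cubeEnl (F.P p.K) (sideχ F ν p g 0) c 2)
  rw [Finset.mem_filter]
  refine ⟨Finset.mem_univ _, ?_⟩
  rcases hb with rfl | rfl | rfl | rfl
  · exact ⟨h12 h1, h12 h2⟩
  · exact ⟨h12 h2, h12 h4⟩
  · exact ⟨h12 h3, h4'⟩
  · exact ⟨h12 h1, h12 h3⟩

/-- **(3.3)-LARGENESS FROM ROUGHNESS, EITHER (2.12) BRANCH** (first step): on a (3.2)-SMALL χ₁-cube `□′` (the localized background (2.16) — a minimiser of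
record OR def-R's unit default — is `ε₁η₁²`-flat on `□′^∼`), a plaquette `q ⊂ □′^∼` of the OLD field with `dist1 (U(∂q)) ≥ ε₁η₁² + 4·(2δ₀)` violates the
small-approximate-fluctuation condition (3.3): `U` cannot be `2δ₀`-close to the background on the four bonds of `q`. [cite: Balaban1988Convergent, (3.2)–(3.4) p.265, (2.16)–(2.17) p.257] -/
theorem not_smallApproxFluct_zero_of_chiFactor_eq_one_of_rough (c : Iχ F ν p g 0) (U : GaugeField (F.P p.K) 0 (SU N))
    (V' : GaugeField (F.P p.K) 1 (SU N)) (hflat : chiFactor F N ν p g 0 c V' = 1) {q : Plaq (F.P p.K) 0}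
    (hq : q ∈ plaqInside (cubeEnl (F.P p.K) (sideχ F ν p g 0) c 1))
    (hrough : epsOfRecord ν g 1 * (F.P p.K).eta 1 ^ 2 + 4 * (2 * deltaOfRecord ν g 0 A₁) ≤ dist1 (plaqHol U q)) :
    ¬ SmallApproxFluct (sect3DataOfRecord F N ν M p g 0 s₀) (avOfRecord F N p.K) (2 * deltaOfRecord ν g 0 A₁) U V' c := by
  intro hSAF
  set B : GaugeField (F.P p.K) 0 (SU N) := (sect3DataOfRecord F N ν M p g 0 s₀).UkLoc c V' with hB
  have hBsmall : dist1 (plaqHol B q) < epsOfRecord ν g 1 * (F.P p.K).eta 1 ^ 2 :=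
    plaqSmallOn_ukBox_of_chiFactor_eq_one F N ν p g 0 c V' hflat q hq
  have hbond : ∀ b ∈ plaqBonds q, dist1 (bdev U B b) ≤ 2 * deltaOfRecord ν g 0 A₁ := by
    intro b hb
    have hlt := hSAF b (plaqBonds_subset_bondsStar_zero F N ν M p g s₀ c hq b hb)
    have hconj : dist1 (bdev U B b) = dist1 (U b * (B b)⁻¹) := by
      rw [← GaugeGroup.dist1_conj (bdev U B b) (B b)]
      simp only [bdev, mul_inv_cancel_left]
    rw [hconj]
    exact hlt.le
  have hle := dist1_plaqHol_le_add_of_plaqBonds hbond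
  linarith

/-- **THE ALL-(3.2)-LARGE COARSE FIELD**: at the first step, if EVERY χ₁-cube is (3.2)-LARGE at `V₁` then the all-large-field new sequence `s′₀`
(`Ω₁(s′₀) = ∅`) carries the FULL step weight, `w(s′₀)(U,V₁) = 1`, for EVERY old field `U` (ζ-unity; `0 <` the two cube sides).
[cite: Balaban1988Convergent, (3.2)–(3.5) p.265, §3 p.267, p.270] -/
theorem wOfRecord_zero_eq_one_of_forall_chiFactor_eq_zero {ζ : ZetaOfRecord F N ν M} (hζ : IsZetaUnity F N ν M ζ)
    (hD : 0 < sideD F ν M p g 0) (hχ : 0 < sideχ F ν p g 0) (s' : SeqOfRecord F ν M g p.K 1) (hΩ : s'.Ω 1 = ∅)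
    (U : GaugeField (F.P p.K) 0 (SU N)) (V' : GaugeField (F.P p.K) 1 (SU N)) (h : ∀ c : Iχ F ν p g 0, chiFactor F N ν p g 0 c V' = 0) :
    wOfRecord F N ν M A₁ ζ p g 0 s' U V' = 1 := by
  have ha : aWeight F N ν M p g 0 s'.init Finset.univ V' = 1 := by
    rw [← cubes32_zero F ν M p g s'.init]
    exact aWeight_cubes32_eq_one_of_forall_chiFactor_eq_zero F N ν M p g 0 s'.init V' fun c _ => h c
  exact wOfRecord_eq_one_of_aWeight_eq_one F N ν M A₁ p g 0 hζ s' hΩ Finset.univ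
    (fun Ql => OmegaOfLabel_zero_eq_empty_of_fst_eq_univ F ν M p g s'.init hD hχ (Finset.univ, Ql, (∅, ∅)) rfl) U V' ha

/-- **THE ALL-(3.2)-SMALL COARSE FIELD AGAINST A CUBE-ROUGH OLD FIELD**: at the first step, if EVERY χ₁-cube is (3.2)-SMALL at `V₁` and the old field `U` has
in every `□′^∼` a plaquette with `dist1 ≥ ε₁η₁² + 4·(2δ₀)`, then `w(s′₀)(U,V₁) = 1` (the label `(P,Q) = (∅, all)` is charged and has `Ω₁ = ∅`).
[cite: Balaban1988Convergent, (3.2)–(3.5) p.265, §3 p.267, p.270] -/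
theorem wOfRecord_zero_eq_one_of_forall_chiFactor_eq_one_of_cubeRough {ζ : ZetaOfRecord F N ν M} (hζ : IsZetaUnity F N ν M ζ)
    (hD : 0 < sideD F ν M p g 0) (hχ : 0 < sideχ F ν p g 0) (s' : SeqOfRecord F ν M g p.K 1) (hΩ : s'.Ω 1 = ∅)
    (U : GaugeField (F.P p.K) 0 (SU N)) (V' : GaugeField (F.P p.K) 1 (SU N)) (h : ∀ c : Iχ F ν p g 0, chiFactor F N ν p g 0 c V' = 1)
    (hU : ∀ c : Iχ F ν p g 0, ∃ q ∈ plaqInside (cubeEnl (F.P p.K) (sideχ F ν p g 0) c 1),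
      epsOfRecord ν g 1 * (F.P p.K).eta 1 ^ 2 + 4 * (2 * deltaOfRecord ν g 0 A₁) ≤ dist1 (plaqHol U q)) :
    wOfRecord F N ν M A₁ ζ p g 0 s' U V' = 1 := by
  refine le_antisymm (wOfRecord_le_one_of_Omega_empty F N ν M A₁ p g 0 hζ s' hΩ U V') ?_
  have ha : aWeight F N ν M p g 0 s'.init ∅ V' = 1 :=
    aWeight_empty_eq_one_of_forall_chiFactor_eq_one F N ν M p g 0 s'.init V' fun c _ => h c
  have hb : bWeight F N ν M p g 0 A₁ s'.init ∅ Finset.univ U V' = 1 := by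
    rw [← qcubes_zero_empty F ν M p g s'.init]
    refine bWeight_qcubes_eq_one_of_forall_not_smallApproxFluct F N ν M A₁ p g 0 s'.init ∅ U V' fun c _ => ?_
    obtain ⟨q, hq, hr⟩ := hU c
    exact not_smallApproxFluct_zero_of_chiFactor_eq_one_of_rough F N ν M A₁ p g s'.init c U V' (h c) hq hr
  have hle := aWeight_mul_bWeight_le_wOfRecord_of_OmegaOfLabel_eq_empty F N ν M A₁ p g 0 hζ s' hΩ ∅ Finset.univ
    (OmegaOfLabel_zero_empty_univ_eq_empty F ν M p g s'.init hD hχ (∅, ∅)) U V'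
  rw [ha, hb, one_mul] at hle
  exact hle

end Extreme

end Literature.MathematicalPhysics.QuantumFieldTheory.Balaban1983to89.Node00

end
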